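import Summits.BirchSwinnertonDyer.Rank1Residual.X11b.Three.KolyvaginNonvanishing
import Summits.BirchSwinnertonDyer.Rank1Residual.X11b.Three.HeegnerIndexCertificate
import Summits.BirchSwinnertonDyer.BirchSwinnertonDyer.Theorems.RungK2Hub
import Literature.NumberTheory.EllipticCurves.Rank1Residual.X9NoEntry
import Literature.NumberTheory.EllipticCurves.BSDSelmerSkinnerProofs
import Literature.NumberTheory.EllipticCurves.BSDSelmerPConverseRamifiedProofs

/-!
# Route `ErratumRoadFive` (rung K2a, D-0059) — the Kolyvagin road CLOSES `BSD(E,p)` on the Locus at ONE odd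
# Heegner datum: a non-zero mod-p Kolyvagin class + McCallum + the published inputs ⟹ `BSDp W p`, `p ≥ 5`
# (cell `bsd-stepL`, seat `bsd-stepL-koly` g6; `--supports stmt-BirchSwinnertonDyer-19061`)

The END-TO-END form of the Kolyvagin road at `p ∥ N`, `p ≥ 5`, in the class record's vocabulary, composing the
tree kernels `Koly.indexLowerBoundAt_of_kolyvaginClass_one_ne_zero_of_mccallum` (a non-zero class `c₁(n)`,
`n ∈ Λ`, is a level-1 certificate; McCallum's `ord_p #Ш(E/K) = 2(M₀ − M_∞)` gives STEP L
`X11b.IndexLowerBoundAt W p K P`) and `X11b.bsdp_of_indexLowerBoundAt_of_heegnerData_of_odd` (STEP L at ONE odd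
Heegner datum on A1 ∧ (ram) gives `BSD(E,p)`). Binders = those of the tree's certificate endpoint
`bsdp_of_heegnerIndexCertificate` (`X11b/Three/HeegnerIndexCertificate.lean`) with the index certificate
REPLACED by the Kolyvagin road's inputs (a conductor-1 Kolyvagin–Heegner datum for `(Dt, β, ι)` descending to
`P`; the arithmetic of `E(K)`; ONE non-zero class `c₁(n)` for the same `(Dt, β, ι)` — the conclusion of
`Koly.SkinnerZhangSharp` ∕ of Skinner–Zhang's Thm 1.3 for the datum they name —; the McCallum fact). New:
tower surjectivity `ρ̄_{E,p^m}` onto is DISCHARGED (`hasSurjectiveModNGaloisRep_pow_of_hasMultiplicativeReductionAtPrime`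
from `Surj ∧ Ram`; `Surj` from `Irr ∧ Ram` by `surj_of_irr_of_ram`); non-CM from the multiplicative prime;
`d_K ≠ −4` from oddness (`d_K ≠ −3` stays a binder of the McCallum kernel). THEOREMS ONLY; the non-zero class
is a HYPOTHESIS (`hne`); nothing is asserted about Kolyvagin's conjecture.
-/

noncomputable section

open scoped Classical

namespace Summit.BirchSwinnertonDyer.Rank1Residual.X11b.Three.Koly

open WeierstrassCurve Literature.NumberTheory.EllipticCurves
  Literature.NumberTheory.EllipticCurves.ModularForms
  Literature.NumberTheory.EllipticCurves.Rank1Residual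
  Summit.BirchSwinnertonDyer.Rank1Residual Summit.BirchSwinnertonDyer.Rank1Residual.X11b

/-- **KOLYVAGIN ROAD, END TO END, at `p ≥ 5` on A1 ∧ (ram) (the Locus): one non-zero mod-`p` Kolyvagin class
at one odd Heegner datum ⟹ `BSD(E,p)`.** For `(E,p)` in class X11b (`r_an = 1`, `p ∥ N` multiplicative, `E[p]`
irreducible), `p ≥ 5`, with a (ram) witness and `p ∤ ∏_ℓ c_ℓ(E)`; an imaginary quadratic `K` with ODD
`d_K ≠ −3`, Heegner for `N_E`, `p ∤ #𝓞_K^×`, `L(E^{d_K}, 1) ≠ 0` (with a minimal model `Wd` of the twist); a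
modular parametrisation datum `Dt` of level `N_E` with `p ∤ c(Dt)`, an oriented Heegner datum `H` and
`ι : K → ℂ` with the Heegner point `P ∈ E(K)`, `P ↦ heegnerPointComplex Dt H`; a conductor-1 Kolyvagin–Heegner
datum `d₁` for `(Dt, β, ι)` whose derived point is `P` in `E(K̄)`; `P` of infinite order with `p^{M₀} ∥ P`, `E(K)`
of rank one without `p`-torsion, `Ш(E/K)` finite; the published inputs (`hGZ hKo hB hSk hGZK hmod`): IF some
Kolyvagin–Heegner datum `d` at a square-free product `n` of Kolyvagin primes for `(Dt, β, ι)` has `c₁(n) ≠ 0`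
(`hne`; HYPOTHESIS — Skinner–Zhang's Thm 1.3 ∕ `Koly.SkinnerZhangSharp` for this datum) and the McCallum fact
holds (`hMc`), THEN `BSDp W p`. Tower surjectivity is a theorem here (`Surj ∧ Ram`). CONDITIONAL on the named
facts listed and on `hne`, `hMc`. [folklore]
[cite: McCallumLMS1991, §5 Cor. 5.6 (p. 310)] [cite: JetchevSkinnerWan2017, §7.4.1–7.4.2 (pp. 30–31)]
[cite: SkinnerZhang2014, Thm. 1.3 and §12.3 (shape of `hne` and of the deduction)] -/
theorem ClassX11b.bsdp_of_kolyvaginClass_one_ne_zero_of_mccallum_of_five_le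
    (W : WeierstrassCurve ℚ) [W.IsElliptic] [W.IsGloballyMinimal] (p : ℕ) [hp : Fact p.Prime]
    [NeZero (W.conductorNorm ℤ)] (K : Type) [Field K] [NumberField K]
    (Dt : ModularParametrizationData W (W.conductorNorm ℤ))
    (H : HeegnerDatum (W.conductorNorm ℤ) (NumberField.discr K)) (ι : K →+* ℂ)
    (P : (W.baseChange K).toAffine.Point)
    -- published inputs (named facts of the tree)
    (hGZ : gross_zagier (W.conductorNorm ℤ) W K) (hKo : kolyvagin (W.conductorNorm ℤ) W K)
    (hB : Kolyvagin1990_padicValNat_card_sha_le (W.conductorNorm ℤ) W K)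
    (hSk : Skinner2016.thmC_padicValRat_bsd_rank_zero)
    (hGZK : rank_eq_analyticRank_of_analyticRank_le_one) (hmod : hasEntireLFunction_rat)
    -- the pair: A1 ∧ (ram), p ≥ 5
    (hX : ClassX11b W p) (hp5 : 5 ≤ p) (hram : Ram W p) (htam0 : ¬ p ∣ W.tamagawaProduct)
    -- ONE odd Heegner datum
    (hK : IsImaginaryQuadratic K) (hodd : Odd (NumberField.discr K)) (h3 : NumberField.discr K ≠ -3)
    (hHN : SatisfiesHeegnerHypothesis (W.conductorNorm ℤ) K)
    (hP : WeierstrassCurve.Affine.Point.map ι.toRatAlgHom P = heegnerPointComplex Dt H)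
    (hc : ¬ (p : ℤ) ∣ Dt.c) (hμ : ¬ p ∣ NumberField.Units.torsionOrder K)
    (hLt : (W.quadraticTwist (NumberField.discr K : ℚ)).entireLFunction 1 ≠ 0)
    (Wd : WeierstrassCurve ℚ) [Wd.IsElliptic] [Wd.IsGloballyMinimal] (Cd : VariableChange ℚ)
    (hWd : Cd • W.quadraticTwist (NumberField.discr K : ℚ) = Wd)
    -- Kolyvagin–Heegner data at conductor 1 for (Dt, β, ι), descending to P; arithmetic of E(K)
    (β : ℤ) (d₁ : KolyvaginHeegnerData Dt β ι 1)
    (hPd : d₁.toGeomPoints d₁.derivedPoint = toGeomPoints (W.baseChange K) P)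
    (hPinf : ¬ IsOfFinAddOrder P)
    (hrank : (W.baseChange K).mordellWeilRank = 1)
    (hiv : ∀ x : (W.baseChange K).toAffine.Point, p • x = 0 → x = 0)
    [Finite (W.baseChange K).sha] {M₀ : ℕ}
    (hdiv : ∃ Q : (W.baseChange K).toAffine.Point, ((p ^ M₀ : ℕ) : ℤ) • Q = P)
    (hndiv : ¬ ∃ Q : (W.baseChange K).toAffine.Point, ((p ^ (M₀ + 1) : ℕ) : ℤ) • Q = P)
    -- THE KOLYVAGIN-ROAD INPUTS: a non-zero mod-p class for this datum, and the McCallum fact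
    {n : ℕ} (d : KolyvaginHeegnerData Dt β ι n)
    (hn : KolyvaginDescent.KolSupp (Zhang2014.IsKolyvaginPrime (W.conductorNorm ℤ) W K p) n)
    (hne : d.kolyvaginClass hp.out 1 ≠ 0)
    (hMc : McCallum1991_pow_dvd_card_sha_primary_of_certificate) :
    BSDp W p := by
  have hmult : W.HasMultiplicativeReductionAtPrime p := hX.2.2.1
  have hirr : Irr W p := hX.2.2.2
  have hp2 : p ≠ 2 := by omega
  have hρ : Surj W p := surj_of_irr_of_ram W p hirr hram
  -- tower surjectivity from `Surj ∧ Ram` (unipotent inertia at the ramified multiplicative prime; tree)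
  have hsurj : ∀ m : ℕ, W.HasSurjectiveModNGaloisRep (p ^ m : ℕ) :=
    hasSurjectiveModNGaloisRep_pow_of_hasMultiplicativeReductionAtPrime W p hρ hram
  have hCM : ¬ W.HasCM := not_hasCM_of_hasMultiplicativeReductionAtPrime' W hmult
  have h4 : NumberField.discr K ≠ -4 := by
    intro h
    rw [h] at hodd
    exact (Int.not_odd_iff_even.mpr ⟨-2, by norm_num⟩) hodd
  -- STEP L at the datum from the non-zero class (McCallum)
  have hL : IndexLowerBoundAt W p K P :=
    indexLowerBoundAt_of_kolyvaginClass_one_ne_zero_of_mccallum W K hMc hCM hK h3 h4 hHN p hp2 hsurj Dt β ι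
      d₁ P hPd hPinf hrank hiv hdiv hndiv d hn hne
  -- STEP L at ONE odd datum on A1 ∧ (ram) ⟹ BSD(E,p)
  exact bsdp_of_indexLowerBoundAt_of_heegnerData_of_odd W p K Dt H ι P hGZ hKo hB hSk hGZK hmod hX hram
    htam0 hK hodd hHN hP hc hμ hLt Wd Cd hWd hL

end Summit.BirchSwinnertonDyer.Rank1Residual.X11b.Three.Koly

end
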